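import Summits.QuantumFields.BalabanUV.T4Continuum.Support.VariationalColourTaxiTowerBridge
import Summits.QuantumFields.BalabanUV.T4Continuum.Support.CompositeFibreRelabel
import Summits.QuantumFields.BalabanUV.T4Continuum.Support.VariationalVectorLandauTower
import Summits.QuantumFields.BalabanUV.T4Continuum.Support.VariationalVectorDivHessian
import Summits.QuantumFields.BalabanUV.T4Continuum.Support.VariationalVectorOneStepPhys

/-!
# T⁴ programme, spine node NE2 (U1a), lane P2 — «V-AVG-G AT TAXI DATA», file 3: V-REG′ — THE REGULARITY OF THE (G″) FUNCTIONAL `ρ′` AT FINE MINIMISERS OF THE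
# COMPOSITE FIBRE, BY TRANSPORT OF THE LEVEL-(k+1) SOCKETS ALONG `sites` (Bałaban's taxi data, straight-taxi kernels; model level, `E = ℂ`; cell `pub-balaban`)

NE2 formalisation swarm `b2b-balaban-t4-ne2-formalise-*`, leaf prover 10 GEN 5 (`prover-b2b-balaban-t4-ne2-formalise-leaf-10-g5-0`, V-END holder lineage); item
«V-AVG-G AT TAXI DATA» (CLAIMS.log 2026-08-20, ONLINE gen 5), file F3.  Composition BY NAME of leaf-04-g7's read-outs `VariationalColourTaxiTowerBridge.{cast_pow_succ,
SfV_G2'_eq, QvL_nestLv_succ_comp}` (p237444), the transport kit `VariationalVectorTower.{qVV_eq_transport, roughV_transport, comp_symm_comp}` (leaf-10-g3 p218948),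
`VariationalVectorLandauTower.divSq_transport` (p220989), leaf-03-g7's `CompositeFibreRelabel.cDv_transport` (p236855) and leaf-01-g9's
`VariationalVectorDivHessian.sum_diag_le_roughV` (p234963); nothing defined; one 15-line transport lemma for the covariant Hessian (§1).

THE POINT.  File 1's END (`towerLimitRate_effV_taxiTower_avgG`) displays `hREGf k`: V-REG for the fine regularity functional `ρ′_k` of (G″) at fine minimisers `g` of the
level-`k` composite fibre `{Q_k(Q_{T′ k} g) = φ}`.  File 2 fixed `ρ′_k g = ρ_D + DIVSQ♯ = ((L^kL)⁴∕(L^kL)^d)·hessV (R′ k) g + ((L^kL)²∕(L^kL)^d)·Σ_μΣ_x‖(D_μg_μ)(x)‖² +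
qVV g + ((L^kL)^d)⁻¹((L^kL)²·divSq (R′ k) g)`.  Under the END's COMP identities (`nestLv (k+1) = compL (nestLv k) (T′ k)`, `Rlev (k+1) = Rtrv (R′ k)`,
`G′ k = G (k+1) ∘ (· ∘ sites)`) a fine minimiser of the composite fibre IS, read through `sites`, a fibre minimiser at level `k+1` (`QvL_comp′`, `SfV_eq_transport`,
`Gtr_pullback`), and the four summands are, read through `sites`, `rhoV (L^{k+1})` (§1 `hessV_transport`), `≤ c_f·roughV (L^{k+1})` (`sum_diag_le_roughV` + `roughV_transport`),
`qWV (L^{k+1})` (`qVV_eq_transport`) and `c_f·divSq (L^{k+1})` (`divSq_transport`) — so V-REG′_k follows from the level-(k+1) sockets V-REG ∕ (Går) ∕ V-P ∕ (GF3) of parts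
6–8 (for Bałaban's `projG (Rlev (k+1)) (ker Q_{taxi,k+1})` the first three are `VariationalColourTaxiTowerProjGRegularRate.projG_sockets_nestLv` at `k+1`, the fourth is part 7's
`hGdiv_projG_nestLv_regular`) with `CR′ = C_R + C_Går + C_Går′ + C_P + C_D + C_D′`:
  **`hREGf_projG_taxi`** — the END's `hREGf k` binder in parts 6–8's letters, the level-(k+1) sockets DISPLAYED with free constants.

HONEST FRAMING (T4-DAG p. 1).  Model level (c5, `E = ℂ`); [folklore] re-indexing; the level-(k+1) sockets are hypotheses here (inhabited in the host); nothing printed is a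
hypothesis; no `def`, no `def … : Prop`, no `sorry`; axioms standard.  NOT an END statement; V-END with background ∕ NE2 NOT proved; NE3 OPEN; spine PROVED 0∕9
unchanged; rung (B)+1 on a fixed finite T⁴ — NOT infinite volume, NOT mass gap, NOT Clay.  HONEST DEPENDENCY (cell, verbatim): continuum YM on T⁴ ⇐ BetaPertH ∧ nine
spine estimates (0/9 proved); BetaPertH ⇐ (D1) ∧ (D4) ∧ CAP+tail; G-an2-4 gates asym, D1 and NE2/3/4.
-/

noncomputable section

namespace Summit.QuantumFields.BalabanUV.T4Continuum.VariationalColourTaxiTowerAvgGReg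

open Finset
open Literature.MathematicalPhysics.QuantumFieldTheory.Balaban1983to89.B5Prop11Plancherel (Tor fine unitVec)
open Literature.MathematicalPhysics.QuantumFieldTheory.Balaban1983to89.B5Composition116 (sites)
open Summit.QuantumFields.BalabanUV.T4Continuum.VariationalColourFederbush (cDv dirUv)
open Summit.QuantumFields.BalabanUV.T4Continuum.VariationalColourTower (Rtrv)
open Summit.QuantumFields.BalabanUV.T4Continuum.VariationalColourTaxiTransport
open Summit.QuantumFields.BalabanUV.T4Continuum.VariationalVectorFederbush (lineT)
open Summit.QuantumFields.BalabanUV.T4Continuum.VectorBlockTrialForm (nsqV nsqV_nonneg QvL roughV)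
open Summit.QuantumFields.BalabanUV.T4Continuum.VariationalVectorForm (ScV SfV qWV qVV cdV ScV_nonneg)
open Summit.QuantumFields.BalabanUV.T4Continuum.VariationalVectorTower (qVV_eq_transport roughV_transport comp_symm_comp)
open Summit.QuantumFields.BalabanUV.T4Continuum.VariationalVectorWeitzenbock (divSq)
open Summit.QuantumFields.BalabanUV.T4Continuum.VariationalVectorGaugeSlice (avgOp projG projG_nonneg)
open Summit.QuantumFields.BalabanUV.T4Continuum.VariationalVectorOneStep (hessV)
open Summit.QuantumFields.BalabanUV.T4Continuum.VariationalColourInterpolant (hessv)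
open Summit.QuantumFields.BalabanUV.T4Continuum.VariationalVectorOneStepPhys (rhoV)
open Summit.QuantumFields.BalabanUV.T4Continuum.VariationalVectorLandauTower (divSq_transport)
open Summit.QuantumFields.BalabanUV.T4Continuum.VariationalVectorDivHessian (sum_diag_le_roughV)
open Summit.QuantumFields.BalabanUV.T4Continuum.CompositeFibreRelabel (cDv_transport)

variable {d : ℕ}

/-! ## §1 The covariant Hessian is transported along `sites` -/

section Transport

variable {E : Type*} [NormedAddCommGroup E] [InnerProductSpace ℂ E] [CompleteSpace E]
variable (n L : ℕ) [NeZero n] [NeZero L] (M : Fin d → ℕ) [hM : ∀ μ, NeZero (M μ)]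

omit [CompleteSpace E] in
/-- **the covariant Hessian of a 1-form is transported**: `hessV (fine (n·L) M) (Rtrv R′) (W′ ∘ sites) = hessV (fine L (fine n M)) R′ W′` (two applications of leaf-03-g7's
`cDv_transport`, then the site sum re-indexed along `sites`). [folklore] -/
theorem hessV_transport (R' : Tor (fine L (fine n M)) → Fin d → (E →L[ℂ] E)) (W' : Tor (fine L (fine n M)) → Fin d → E) :
    hessV (fine (n * L) M) (Rtrv n L M R') (W' ∘ sites n L M) = hessV (fine L (fine n M)) R' W' := by
  unfold hessV hessv dirUv
  refine sum_congr rfl fun ν _ => sum_congr rfl fun μ _ => sum_congr rfl fun κ _ => ?_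
  have h1 : (fun z => cDv (fine (n * L) M) (Rtrv n L M R') (fun z => (W' ∘ sites n L M) z ν) z κ)
      = (fun z' => cDv (fine L (fine n M)) R' (fun z => W' z ν) z' κ) ∘ sites n L M := by
    funext z
    exact cDv_transport n L M R' (fun z => W' z ν) z κ
  rw [h1]
  calc ∑ y, ‖cDv (fine (n * L) M) (Rtrv n L M R') ((fun z' => cDv (fine L (fine n M)) R' (fun z => W' z ν) z' κ) ∘ sites n L M) y μ‖ ^ 2
      = ∑ y, ‖cDv (fine L (fine n M)) R' (fun z' => cDv (fine L (fine n M)) R' (fun z => W' z ν) z' κ) (sites n L M y) μ‖ ^ 2 :=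
        sum_congr rfl fun y _ => by rw [cDv_transport]
    _ = ∑ y', ‖cDv (fine L (fine n M)) R' (fun z' => cDv (fine L (fine n M)) R' (fun z => W' z ν) z' κ) y' μ‖ ^ 2 :=
        Equiv.sum_comp (sites n L M) (fun y' => ‖cDv (fine L (fine n M)) R' (fun z' => cDv (fine L (fine n M)) R' (fun z => W' z ν) z' κ) y' μ‖ ^ 2)

end Transport

/-! ## §2 V-REG′ at fine minimisers of the composite fibre from the level-(k+1) sockets -/

section Reg

variable (L : ℕ) [NeZero L] (M : Fin d → ℕ) [hM : ∀ μ, NeZero (M μ)]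
variable {R' : (k : ℕ) → Tor (fine L (fine (L ^ k) M)) → Fin d → (ℂ →L[ℂ] ℂ)}

/-- **V-REG′ AT BAŁABAN's TAXI DATA** — file 1's `hREGf k` for parts 6–8's `G k := projG (Rlev k) (ker Q_{taxi,k})`, `G′ k := G (k+1) ∘ (· ∘ sites)` and file 2's
`ρ′_k = ((L^kL)⁴∕(L^kL)^d)·hessV (R′ k) g + ((L^kL)²∕(L^kL)^d)·Σ_μΣ_x‖(D_μg_μ)(x)‖² + qVV g + ((L^kL)^d)⁻¹((L^kL)²·divSq (R′ k) g)`: at a fine minimiser `g` of the level-`k`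
composite fibre, `ρ′_k g ≤ (C_R + C_Går + C_Går′ + C_P + C_D + C_D′)·(SfV (R′ k) (G′ k) g + ‖φ‖²)`, GIVEN the level-(k+1) sockets V-REG (`C_R`), (Går) (`C_Går, C_Går′ ≥ 0`),
V-P (`C_P`) and (GF3) (`C_D, C_D′ ≥ 0`) for `G (k+1)` — a fine minimiser of the composite fibre is a level-(k+1) fibre minimiser read through `sites`. [folklore] -/
theorem hREGf_projG_taxi (k : ℕ) {CR CGar CGar' CP CD CD' : ℝ} (hCGar : 0 ≤ CGar) (hCGar' : 0 ≤ CGar') (hCD : 0 ≤ CD) (hCD' : 0 ≤ CD')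
    (hREG1 : ∀ (φ : Tor M → Fin d → ℂ) (W : Tor (fine (L ^ (k + 1)) M) → Fin d → ℂ), QvL (L ^ (k + 1)) M (nestLv L M R' (k + 1)) W = φ →
      (∀ W₂, QvL (L ^ (k + 1)) M (nestLv L M R' (k + 1)) W₂ = φ →
        ScV (L ^ (k + 1)) M (Rlev L M R' (k + 1)) (projG (fine (L ^ (k + 1)) M) (Rlev L M R' (k + 1))
          (LinearMap.ker (avgOp (L ^ (k + 1)) M (taxiTv (L ^ (k + 1)) M (Rlev L M R' (k + 1)))))) W
        ≤ ScV (L ^ (k + 1)) M (Rlev L M R' (k + 1)) (projG (fine (L ^ (k + 1)) M) (Rlev L M R' (k + 1))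
          (LinearMap.ker (avgOp (L ^ (k + 1)) M (taxiTv (L ^ (k + 1)) M (Rlev L M R' (k + 1)))))) W₂) →
      rhoV (L ^ (k + 1)) M (Rlev L M R' (k + 1)) W
        ≤ CR * (ScV (L ^ (k + 1)) M (Rlev L M R' (k + 1)) (projG (fine (L ^ (k + 1)) M) (Rlev L M R' (k + 1))
          (LinearMap.ker (avgOp (L ^ (k + 1)) M (taxiTv (L ^ (k + 1)) M (Rlev L M R' (k + 1)))))) W + nsqV M φ))
    (hGar1 : ∀ W : Tor (fine (L ^ (k + 1)) M) → Fin d → ℂ,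
      ((((L ^ (k + 1) : ℕ) : ℝ)) ^ d)⁻¹ * ((((L ^ (k + 1) : ℕ) : ℝ)) ^ 2 * roughV (L ^ (k + 1)) M (Rlev L M R' (k + 1)) W)
        ≤ CGar * ScV (L ^ (k + 1)) M (Rlev L M R' (k + 1)) (projG (fine (L ^ (k + 1)) M) (Rlev L M R' (k + 1))
            (LinearMap.ker (avgOp (L ^ (k + 1)) M (taxiTv (L ^ (k + 1)) M (Rlev L M R' (k + 1)))))) W
          + CGar' * nsqV M (QvL (L ^ (k + 1)) M (nestLv L M R' (k + 1)) W))
    (hP1 : ∀ W : Tor (fine (L ^ (k + 1)) M) → Fin d → ℂ,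
      qWV (L ^ (k + 1)) M W ≤ CP * (ScV (L ^ (k + 1)) M (Rlev L M R' (k + 1)) (projG (fine (L ^ (k + 1)) M) (Rlev L M R' (k + 1))
        (LinearMap.ker (avgOp (L ^ (k + 1)) M (taxiTv (L ^ (k + 1)) M (Rlev L M R' (k + 1)))))) W + nsqV M (QvL (L ^ (k + 1)) M (nestLv L M R' (k + 1)) W)))
    (hGdiv1 : ∀ W : Tor (fine (L ^ (k + 1)) M) → Fin d → ℂ,
      ((((L ^ (k + 1) : ℕ) : ℝ)) ^ d)⁻¹ * ((((L ^ (k + 1) : ℕ) : ℝ)) ^ 2 * divSq (fine (L ^ (k + 1)) M) (Rlev L M R' (k + 1)) W)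
        ≤ CD * ScV (L ^ (k + 1)) M (Rlev L M R' (k + 1)) (projG (fine (L ^ (k + 1)) M) (Rlev L M R' (k + 1))
            (LinearMap.ker (avgOp (L ^ (k + 1)) M (taxiTv (L ^ (k + 1)) M (Rlev L M R' (k + 1)))))) W
          + CD' * nsqV M (QvL (L ^ (k + 1)) M (nestLv L M R' (k + 1)) W))
    (φ : Tor M → Fin d → ℂ) (g : Tor (fine L (fine (L ^ k) M)) → Fin d → ℂ)
    (hg : QvL (L ^ k) M (nestLv L M R' k) (QvL L (fine (L ^ k) M) (lineT L (fine (L ^ k) M) (taxiTv L (fine (L ^ k) M) (R' k)) (R' k)) g) = φ)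
    (hmin : ∀ W', QvL (L ^ k) M (nestLv L M R' k) (QvL L (fine (L ^ k) M) (lineT L (fine (L ^ k) M) (taxiTv L (fine (L ^ k) M) (R' k)) (R' k)) W') = φ →
      SfV (L ^ k) L M (R' k) (fun W' => projG (fine (L ^ (k + 1)) M) (Rlev L M R' (k + 1))
        (LinearMap.ker (avgOp (L ^ (k + 1)) M (taxiTv (L ^ (k + 1)) M (Rlev L M R' (k + 1))))) (W' ∘ sites (L ^ k) L M)) g
      ≤ SfV (L ^ k) L M (R' k) (fun W' => projG (fine (L ^ (k + 1)) M) (Rlev L M R' (k + 1))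
        (LinearMap.ker (avgOp (L ^ (k + 1)) M (taxiTv (L ^ (k + 1)) M (Rlev L M R' (k + 1))))) (W' ∘ sites (L ^ k) L M)) W') :
    ((((L ^ k : ℕ) : ℝ)) * L) ^ 4 / ((((L ^ k : ℕ) : ℝ)) * L) ^ d * hessV (fine L (fine (L ^ k) M)) (R' k) g
        + ((((L ^ k : ℕ) : ℝ)) * L) ^ 2 / ((((L ^ k : ℕ) : ℝ)) * L) ^ d * ∑ μ : Fin d, ∑ x : Tor (fine L (fine (L ^ k) M)), ‖cdV (fine L (fine (L ^ k) M)) (R' k) g x μ μ‖ ^ 2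
        + qVV (L ^ k) L M g
        + (((((L ^ k : ℕ) : ℝ)) * L) ^ d)⁻¹ * (((((L ^ k : ℕ) : ℝ)) * L) ^ 2 * divSq (fine L (fine (L ^ k) M)) (R' k) g)
      ≤ (CR + CGar + CGar' + CP + CD + CD')
        * (SfV (L ^ k) L M (R' k) (fun W' => projG (fine (L ^ (k + 1)) M) (Rlev L M R' (k + 1))
            (LinearMap.ker (avgOp (L ^ (k + 1)) M (taxiTv (L ^ (k + 1)) M (Rlev L M R' (k + 1))))) (W' ∘ sites (L ^ k) L M)) g + nsqV M φ) := by
  -- the fine minimiser read at level `k+1`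
  have eQ : QvL (L ^ (k + 1)) M (nestLv L M R' (k + 1)) (g ∘ sites (L ^ k) L M) = φ := by rw [← QvL_nestLv_succ_comp]; exact hg
  have hminW : ∀ W₂, QvL (L ^ (k + 1)) M (nestLv L M R' (k + 1)) W₂ = φ →
      ScV (L ^ (k + 1)) M (Rlev L M R' (k + 1)) (projG (fine (L ^ (k + 1)) M) (Rlev L M R' (k + 1))
        (LinearMap.ker (avgOp (L ^ (k + 1)) M (taxiTv (L ^ (k + 1)) M (Rlev L M R' (k + 1)))))) (g ∘ sites (L ^ k) L M)
      ≤ ScV (L ^ (k + 1)) M (Rlev L M R' (k + 1)) (projG (fine (L ^ (k + 1)) M) (Rlev L M R' (k + 1))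
        (LinearMap.ker (avgOp (L ^ (k + 1)) M (taxiTv (L ^ (k + 1)) M (Rlev L M R' (k + 1)))))) W₂ := by
    intro W₂ hW₂
    -- the competitor read in one-step coordinates
    have e : ((fun y μ => W₂ ((sites (L ^ k) L M).symm y) μ) ∘ sites (L ^ k) L M) = W₂ := by
      funext x; funext μ; simp
    have h1 : QvL (L ^ k) M (nestLv L M R' k) (QvL L (fine (L ^ k) M) (lineT L (fine (L ^ k) M) (taxiTv L (fine (L ^ k) M) (R' k)) (R' k))
        (fun y μ => W₂ ((sites (L ^ k) L M).symm y) μ)) = φ := by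
      rw [QvL_nestLv_succ_comp]
      exact (congrArg (QvL (L ^ (k + 1)) M (nestLv L M R' (k + 1))) e).trans hW₂
    have h2 := hmin _ h1
    rw [SfV_G2'_eq, SfV_G2'_eq] at h2
    exact h2.trans_eq (congrArg (ScV (L ^ (k + 1)) M (Rlev L M R' (k + 1)) (projG (fine (L ^ (k + 1)) M) (Rlev L M R' (k + 1))
      (LinearMap.ker (avgOp (L ^ (k + 1)) M (taxiTv (L ^ (k + 1)) M (Rlev L M R' (k + 1))))))) e)
  -- the common right-hand sizes
  set S : ℝ := SfV (L ^ k) L M (R' k) (fun W' => projG (fine (L ^ (k + 1)) M) (Rlev L M R' (k + 1))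
    (LinearMap.ker (avgOp (L ^ (k + 1)) M (taxiTv (L ^ (k + 1)) M (Rlev L M R' (k + 1))))) (W' ∘ sites (L ^ k) L M)) g with hSdef
  have hS0 : 0 ≤ S := by
    rw [hSdef, SfV_G2'_eq]
    exact ScV_nonneg (L ^ (k + 1)) M _ (fun W => projG_nonneg _ _ _ W) _
  have hφ0 : 0 ≤ nsqV M φ := nsqV_nonneg M φ
  -- (1) the Hessian summand = `rhoV` at level `k+1` ⟵ V-REG_{k+1}
  have h1 : ((((L ^ k : ℕ) : ℝ)) * L) ^ 4 / ((((L ^ k : ℕ) : ℝ)) * L) ^ d * hessV (fine L (fine (L ^ k) M)) (R' k) g ≤ CR * (S + nsqV M φ) := by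
    have h := hREG1 φ (g ∘ sites (L ^ k) L M) eQ hminW
    simp only [rhoV] at h
    rw [cast_pow_succ, ← SfV_G2'_eq] at h
    rw [← hessV_transport (L ^ k) L M (R' k) g]
    exact h
  -- (2) the diagonal-gradient summand ≤ the rough form ⟵ (Går)_{k+1}
  have h2 : ((((L ^ k : ℕ) : ℝ)) * L) ^ 2 / ((((L ^ k : ℕ) : ℝ)) * L) ^ d * ∑ μ : Fin d, ∑ x : Tor (fine L (fine (L ^ k) M)), ‖cdV (fine L (fine (L ^ k) M)) (R' k) g x μ μ‖ ^ 2
      ≤ CGar * S + CGar' * nsqV M φ := by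
    have hdiag : ∑ μ : Fin d, ∑ x : Tor (fine L (fine (L ^ k) M)), ‖cdV (fine L (fine (L ^ k) M)) (R' k) g x μ μ‖ ^ 2 ≤ roughV L (fine (L ^ k) M) (R' k) g :=
      sum_diag_le_roughV L (fine (L ^ k) M) (R' k) g
    have h := hGar1 (g ∘ sites (L ^ k) L M)
    rw [cast_pow_succ, ← SfV_G2'_eq, ← QvL_nestLv_succ_comp, hg] at h
    have h' : ((((L ^ k : ℕ) : ℝ) * L) ^ d)⁻¹ * ((((L ^ k : ℕ) : ℝ) * L) ^ 2 * roughV L (fine (L ^ k) M) (R' k) g) ≤ CGar * S + CGar' * nsqV M φ := by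
      rw [← roughV_transport (L ^ k) L M (R' k) g]; exact h
    have hc : 0 ≤ ((((L ^ k : ℕ) : ℝ)) * L) ^ 2 / ((((L ^ k : ℕ) : ℝ)) * L) ^ d := by positivity
    calc ((((L ^ k : ℕ) : ℝ)) * L) ^ 2 / ((((L ^ k : ℕ) : ℝ)) * L) ^ d * ∑ μ : Fin d, ∑ x : Tor (fine L (fine (L ^ k) M)), ‖cdV (fine L (fine (L ^ k) M)) (R' k) g x μ μ‖ ^ 2
        ≤ ((((L ^ k : ℕ) : ℝ)) * L) ^ 2 / ((((L ^ k : ℕ) : ℝ)) * L) ^ d * roughV L (fine (L ^ k) M) (R' k) g := mul_le_mul_of_nonneg_left hdiag hc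
      _ = ((((L ^ k : ℕ) : ℝ) * L) ^ d)⁻¹ * ((((L ^ k : ℕ) : ℝ) * L) ^ 2 * roughV L (fine (L ^ k) M) (R' k) g) := by ring
      _ ≤ CGar * S + CGar' * nsqV M φ := h'
  -- (3) the mass summand ⟵ V-P_{k+1}
  have h3 : qVV (L ^ k) L M g ≤ CP * (S + nsqV M φ) := by
    have h := hP1 (g ∘ sites (L ^ k) L M)
    rw [← SfV_G2'_eq, ← QvL_nestLv_succ_comp, hg] at h
    rw [qVV_eq_transport]
    exact h
  -- (4) the divergence summand ⟵ (GF3)_{k+1}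
  have h4 : (((((L ^ k : ℕ) : ℝ)) * L) ^ d)⁻¹ * (((((L ^ k : ℕ) : ℝ)) * L) ^ 2 * divSq (fine L (fine (L ^ k) M)) (R' k) g) ≤ CD * S + CD' * nsqV M φ := by
    have h := hGdiv1 (g ∘ sites (L ^ k) L M)
    rw [cast_pow_succ, ← SfV_G2'_eq, ← QvL_nestLv_succ_comp, hg] at h
    rw [← divSq_transport (L ^ k) L M (R' k) g]
    exact h
  -- sum
  have e2 : CGar * S + CGar' * nsqV M φ ≤ (CGar + CGar') * (S + nsqV M φ) := by nlinarith
  have e4 : CD * S + CD' * nsqV M φ ≤ (CD + CD') * (S + nsqV M φ) := by nlinarith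
  have htot : ((((L ^ k : ℕ) : ℝ)) * L) ^ 4 / ((((L ^ k : ℕ) : ℝ)) * L) ^ d * hessV (fine L (fine (L ^ k) M)) (R' k) g
        + ((((L ^ k : ℕ) : ℝ)) * L) ^ 2 / ((((L ^ k : ℕ) : ℝ)) * L) ^ d * ∑ μ : Fin d, ∑ x : Tor (fine L (fine (L ^ k) M)), ‖cdV (fine L (fine (L ^ k) M)) (R' k) g x μ μ‖ ^ 2
        + qVV (L ^ k) L M g
        + (((((L ^ k : ℕ) : ℝ)) * L) ^ d)⁻¹ * (((((L ^ k : ℕ) : ℝ)) * L) ^ 2 * divSq (fine L (fine (L ^ k) M)) (R' k) g)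
      ≤ CR * (S + nsqV M φ) + (CGar + CGar') * (S + nsqV M φ) + CP * (S + nsqV M φ) + (CD + CD') * (S + nsqV M φ) := by
    linarith [h1, h2.trans e2, h3, h4.trans e4]
  refine htot.trans (le_of_eq ?_)
  ring

end Reg

end Summit.QuantumFields.BalabanUV.T4Continuum.VariationalColourTaxiTowerAvgGReg

end
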